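import Mathlib.Combinatorics.SimpleGraph.Metric
import Mathlib.Combinatorics.SimpleGraph.Finite
import Mathlib.Combinatorics.SimpleGraph.Connectivity.Subgraph
import Literature.Combinatorics.SimpleGraph.TreeDescendantPartition   -- ★ `TreeLayers.dist_iso_apply` (`dist (φ u) (φ v) = dist u v`), `TreeLayers.exists_rooted_parent` (row 34b's root data; F0P2-p02 (g13))
import HarnessLib

/-!
# Balls in a locally finite graph: finite, root-closed, stable under automorphisms fixing the centre, connected, and large enough to hold any finite set
# (the finite `γ`-invariant convex subtree `Σ = B(o, R)` of Korman 2004 §5 ∕ Meyer–Solleveld 2010 §4)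

Topic `Combinatorics/SimpleGraph`; namespace `Literature.Combinatorics.SimpleGraph.ClosedBall`.  THEOREMS ONLY (no definition, no instance, no notation, no named fact,
no `sorry`), Mathlib + ONE tree-combinatorics import (★ `TreeDescendantPartition`, for `dist_iso_apply`), arbitrary vertex types.  E1 BRICK LEDGER row 41b = census «(SS-K) VIA THE RESOLUTION» v1 (F0P3a-p04 (g31)) §3 (A4) ∕ §5 R-b
(keeper F0P3a-p03 (g29)); consumer: row 41d «THE FINITE SS COMPLEX ON A STABLE SUBTREE» — the chain complex `0 → C₁(Σ) → C₀(Σ) → V|_Σ → 0` of ★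
`Literature.NumberTheory.Automorphic.SchneiderStuhlerTreeExactness(Convex)` lives on a vertex set `Σ` that must be FINITE, ROOT-CLOSED for the root `o` (the `hS` binder of ★
`exists_finsupp_fixedPoints_boundary_eq_of_support_subset`: `x ∈ Σ → G.Adj x y → G.dist o y + 1 = G.dist o x → y ∈ Σ`), STABLE under the stabiliser of `o`, and LARGE enough to
contain a given finite set (`X^γ ∪ S₀`).  The closed ball `Σ := {x | G.dist o x ≤ R}` is all four; this file proves it in Mathlib's letters (`SimpleGraph.dist`, `SimpleGraph.edist`,
`SimpleGraph.ball`, `G ≃g G'`, `Set.Finite`), with no tree hypothesis (only local finiteness ∕ connectedness where needed).  HONEST LABEL: count-neutral generic base layer;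
HC_CM is proved only modulo the 2 remaining named inputs (hLiu418 24832, h413 24833) until rung 0 closes.

THE MATHEMATICS.  (§1) Graph homomorphisms shorten walks, so isomorphisms preserve `edist` (and `dist`: ★ `TreeLayers.dist_iso_apply`).  (§2) In a connected graph the closed `dist`-ball of radius `n` is Mathlib's
open `edist`-ball `G.ball o (n + 1)`.  (§3) `B(o, n+1) ⊆ {o} ∪ ⋃_{w ~ o} B(w, n)` (peel the first step of a shortest walk), so every ball of finite radius is finite as soon as all
neighbourhoods are (induction on the radius) — no properness or tree hypothesis.  (§4) The ball is down-closed for `dist o`, in particular root-closed in ★ row 34b's sense.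
(§5) An isomorphism maps `B_G(o, n)` onto `B_{G'}(φ o, n)`; an automorphism fixing `o` therefore stabilises the ball and the set of edges inside it.  (§6) The edges inside a finite
vertex set are finite; a finite set lies in the ball of radius `sup dist`; neighbours of a finite set are finite and one step further out.  (§7) In a connected graph the ball
induces a connected subgraph (a shortest walk from the centre never leaves it) — so in a tree it is a finite subtree.

DEDUP NOTE.  Walk-length forms of §3∕§5 exist in the percolation layer (`Literature.Barriers.CriticalPhenomena.graphBall_finite`, `mem_graphBall_map`, `edist_iso_eq`, with
measure-theoretic imports); they are deliberately NOT imported into this base layer and are restated here on Mathlib's `SimpleGraph.ball` ∕ `dist`; the `dist`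
transport is taken from ★ `TreeDescendantPartition` (already imported by the consumer chain ★ row 34 ∕ 34b), the only non-Mathlib import.

* §1 `edist_map_le`, `edist_iso` (the `dist` form is ★ `TreeLayers.dist_iso_apply`; reachability: Mathlib `Iso.reachable_iff`).
* §2 `mem_setOf_dist_le_iff_edist`, `setOf_dist_le_eq_ball`.
* §3 `ball_succ_subset`, **`finite_ball`**, `finite_ball_of_ne_top`, `finite_ball_of_locallyFinite`, **`finite_setOf_dist_le`**, `finite_setOf_reachable_dist_le`, `finite_setOf_dist_eq`.
* §4 `mem_setOf_dist_le_of_dist_le`, **`setOf_dist_le_rootClosed`** (★ row 34b's `hS`), `setOf_dist_le_mono`, `self_mem_setOf_dist_le`.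
* §5 `image_ball_iso`, `image_setOf_dist_le_iso`, **`image_setOf_dist_le_of_apply_eq`**, `apply_mem_setOf_dist_le_iff`, `mapsTo_setOf_dist_le`, `mem_mapEdgeSet_iff`,
  **`forall_mem_mapEdgeSet_iff`** (edges inside a `φ`-stable set are `φ.mapEdgeSet`-stable).
* §6 **`finite_edgeSet_inside`**, `finite_setOf_mem_edgeSet_inside`, `subset_setOf_dist_le_sup`, **`exists_subset_setOf_dist_le`**,
  `finite_setOf_exists_adj`, `dist_le_succ_of_adj`.
* §7 `dist_le_of_mem_support`, **`connected_induce_setOf_dist_le`**.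

## References
* [Korman2004] J. Korman, *A character formula for compact elements (the rank one case)* (2004), §5 (the closed ball `B(o,r) = {x | d(o,x) ≤ r}`; Example 12: for a tree the
  truncated building `X^r` is `B(o,r)` — finite, convex, `o ∈ B(o,r)`), §9 Lemma 38 (balls about a point of `X^γ`).
* [MeyerSolleveld2010] R. Meyer, M. Solleveld, *Resolutions for representations of reductive p-adic groups via their buildings*, J. reine angew. Math. 647 (2010), §4 proof of
  Prop. 4.1 («`f(V)` … is contained in `Σ_{x∈Σ₀°} P_x(V)` for some finite convex subcomplex `Σ₀`. Let `Σ` be a `𝒢`-invariant finite convex subcomplex containing `Σ₀`»).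
* [SchneiderStuhler1997] P. Schneider, U. Stuhler, *Representation theory and sheaves on the Bruhat–Tits building*, Publ. Math. IHÉS 85 (1997), II.1 (the building is a locally
  finite polysimplicial complex), III.4.12.
* [Serre1980Trees] J.-P. Serre, *Trees* (1980), I.2 (paths, distance, subtrees).
-/

set_option autoImplicit false

open Set SimpleGraph

namespace Literature.Combinatorics.SimpleGraph.ClosedBall

variable {V W : Type*} {G : SimpleGraph V} {G' : SimpleGraph W}

/-! ## §1 Homomorphisms shorten, isomorphisms preserve the graph distance -/

/-- A graph homomorphism does not increase the extended distance (it maps walks to walks of the same length). [folklore] [cite: Serre1980Trees, I.2] -/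
theorem edist_map_le (f : G →g G') (u v : V) : G'.edist (f u) (f v) ≤ G.edist u v := by
  by_cases h : G.Reachable u v
  · obtain ⟨p, hp⟩ := h.exists_walk_length_eq_edist
    rw [← hp, ← Walk.length_map f]
    exact edist_le _
  · rw [edist_eq_top_of_not_reachable h]
    exact le_top

/-- **Isomorphisms preserve the extended graph distance.** [folklore] [cite: Serre1980Trees, I.2] -/
theorem edist_iso (φ : G ≃g G') (u v : V) : G'.edist (φ u) (φ v) = G.edist u v := by
  refine le_antisymm ?_ ?_
  · by_cases h : G.Reachable u v
    · obtain ⟨p, hp⟩ := h.exists_walk_length_eq_edist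
      rw [← hp, ← Walk.length_map φ.toHom]
      exact edist_le _
    · rw [edist_eq_top_of_not_reachable h]
      exact le_top
  · by_cases h : G'.Reachable (φ u) (φ v)
    · obtain ⟨p, hp⟩ := h.exists_walk_length_eq_edist
      rw [← hp]
      have q := p.map φ.symm.toHom
      have hq : G.edist u v ≤ (p.map φ.symm.toHom).length := by
        have h1 := edist_le (p.map φ.symm.toHom)
        simp only [RelEmbedding.coe_toRelHom, RelIso.coe_toRelEmbedding, RelIso.symm_apply_apply] at h1
        exact h1
      rwa [Walk.length_map] at hq
    · rw [edist_eq_top_of_not_reachable h]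
      exact le_top

/-! ## §2 The closed `dist`-ball is Mathlib's open `edist`-ball -/

/-- For a reachable pair, `G.dist o x ≤ n ↔ G.edist x o < n + 1` (closed `dist`-ball = open `edist`-ball of radius `n + 1`). [cite: Korman2004, §5 (B(o,r) = {x | d(o,x) ≤ r})] -/
theorem mem_setOf_dist_le_iff_edist {o x : V} (h : G.Reachable o x) (n : ℕ) : G.dist o x ≤ n ↔ G.edist x o < n + 1 := by
  rw [edist_comm, ENat.lt_add_one_iff (ENat.coe_ne_top n), ← h.coe_dist_eq_edist, Nat.cast_le]

/-- **In a connected graph the closed ball `{x | G.dist o x ≤ n}` is Mathlib's `G.ball o (n + 1)`.** [cite: Korman2004, §5 (B(o,r))] -/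
theorem setOf_dist_le_eq_ball (hconn : G.Connected) (o : V) (n : ℕ) : {x | G.dist o x ≤ n} = G.ball o (n + 1) := by
  ext x
  rw [mem_setOf_eq, mem_ball, mem_setOf_dist_le_iff_edist (hconn o x)]

/-! ## §3 Balls of finite radius are finite when all neighbourhoods are -/

/-- Peeling the first step of a shortest walk: `B(o, n+1) ⊆ {o} ∪ ⋃_{w ∈ N(o)} B(w, n)` (Mathlib's open balls). [folklore] [cite: SchneiderStuhler1997, II.1] -/
theorem ball_succ_subset (o : V) (n : ℕ) : G.ball o (n + 1) ⊆ insert o (⋃ w ∈ G.neighborSet o, G.ball w n) := by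
  intro x hx
  rcases eq_or_ne x o with rfl | hxo
  · exact mem_insert _ _
  refine mem_insert_of_mem _ ?_
  rw [mem_ball, edist_comm] at hx
  have hle : G.edist o x ≤ n := (ENat.lt_add_one_iff (ENat.coe_ne_top n)).1 hx
  have hne : G.edist o x ≠ ⊤ := ne_top_of_le_ne_top (ENat.coe_ne_top n) hle
  obtain ⟨q, hq⟩ := exists_walk_of_edist_ne_top hne
  cases q with
  | nil => exact absurd rfl hxo
  | @cons _ w _ hadj q' =>
    have hlen : q'.length + 1 ≤ n := by
      have h1 : (((Walk.cons hadj q').length : ℕ) : ℕ∞) ≤ n := by rw [hq]; exact hle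
      rw [Walk.length_cons] at h1
      exact_mod_cast h1
    refine mem_biUnion ((G.mem_neighborSet o w).2 hadj) ?_
    rw [mem_ball, edist_comm]
    calc G.edist w x ≤ q'.length := edist_le q'
      _ < n := by exact_mod_cast (Nat.lt_of_succ_le hlen)

/-- **Balls of finite radius in a graph with finite neighbourhoods are finite** (induction on the radius; no tree or properness hypothesis).
[cite: SchneiderStuhler1997, II.1 (locally finite complex)] [cite: Korman2004, §5 Example 12 (B(o,r) is a finite subcomplex)] -/
theorem finite_ball (hloc : ∀ v, (G.neighborSet v).Finite) (o : V) (n : ℕ) : (G.ball o n).Finite := by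
  induction n generalizing o with
  | zero => rw [Nat.cast_zero, ball_zero]; exact finite_empty
  | succ n ih => exact (((hloc o).biUnion fun w _ => ih w).insert o).subset (ball_succ_subset o n)

/-- The same for any radius `r ≠ ⊤`. [cite: SchneiderStuhler1997, II.1] -/
theorem finite_ball_of_ne_top (hloc : ∀ v, (G.neighborSet v).Finite) (o : V) {r : ℕ∞} (hr : r ≠ ⊤) : (G.ball o r).Finite := by
  obtain ⟨n, rfl⟩ := ENat.ne_top_iff_exists.1 hr
  exact finite_ball hloc o n

/-- The same from Mathlib's `LocallyFinite` instance. [cite: SchneiderStuhler1997, II.1] -/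
theorem finite_ball_of_locallyFinite [G.LocallyFinite] (o : V) (n : ℕ) : (G.ball o n).Finite :=
  finite_ball (fun v => (G.neighborSet v).toFinite) o n

/-- **The closed ball `{x | G.dist o x ≤ n}` of a connected graph with finite neighbourhoods is finite.** [cite: Korman2004, §5 Example 12] [cite: SchneiderStuhler1997, II.1] -/
theorem finite_setOf_dist_le (hloc : ∀ v, (G.neighborSet v).Finite) (hconn : G.Connected) (o : V) (n : ℕ) : {x | G.dist o x ≤ n}.Finite := by
  rw [setOf_dist_le_eq_ball hconn]
  exact finite_ball hloc o (n + 1)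

/-- Without connectedness: the REACHABLE part of the closed ball is finite. [cite: SchneiderStuhler1997, II.1] -/
theorem finite_setOf_reachable_dist_le (hloc : ∀ v, (G.neighborSet v).Finite) (o : V) (n : ℕ) : {x | G.Reachable o x ∧ G.dist o x ≤ n}.Finite :=
  (finite_ball hloc o (n + 1)).subset fun _ hx => (mem_setOf_dist_le_iff_edist hx.1 n).1 hx.2

/-- Spheres are finite. [cite: Serre1980Trees, I.2] -/
theorem finite_setOf_dist_eq (hloc : ∀ v, (G.neighborSet v).Finite) (hconn : G.Connected) (o : V) (n : ℕ) : {x | G.dist o x = n}.Finite :=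
  (finite_setOf_dist_le hloc hconn o n).subset fun _ hx => le_of_eq hx

/-! ## §4 The closed ball is down-closed for `dist o` — in particular root-closed (★ row 34b) -/

/-- Down-closed: a vertex no further from `o` than a vertex of the ball lies in the ball. [cite: Korman2004, §5 Example 12 (d(o,·) convex, B(o,r) convex)] -/
theorem mem_setOf_dist_le_of_dist_le {o x y : V} {n : ℕ} (hx : x ∈ {z | G.dist o z ≤ n}) (hyx : G.dist o y ≤ G.dist o x) : y ∈ {z | G.dist o z ≤ n} :=
  le_trans hyx hx

/-- **ROOT-CLOSED, in ★ row 34b's letters** (`SchneiderStuhlerTreeExactnessConvex.exists_finsupp_fixedPoints_boundary_eq_of_support_subset`, binder `hS`): with every vertex the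
closed ball contains its neighbour one step closer to the root. [cite: Korman2004, §5 Example 12 (B(o,r) convex)] [cite: MeyerSolleveld2010, §4 (finite convex Σ)] -/
theorem setOf_dist_le_rootClosed (o : V) (n : ℕ) :
    ∀ x ∈ {z | G.dist o z ≤ n}, ∀ y, G.Adj x y → G.dist o y + 1 = G.dist o x → y ∈ {z | G.dist o z ≤ n} := by
  intro x hx y _ h
  simp only [mem_setOf_eq] at hx ⊢
  omega

/-- Balls grow with the radius. [cite: Korman2004, §5 (finite convex subcomplexes «arbitrary large … contain any given ball»)] -/
theorem setOf_dist_le_mono (o : V) {m n : ℕ} (h : m ≤ n) : {z | G.dist o z ≤ m} ⊆ {z | G.dist o z ≤ n} :=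
  fun _ hx => le_trans hx h

/-- The centre lies in every closed ball. [cite: Korman2004, §5 (o ∈ B(o,r))] -/
theorem self_mem_setOf_dist_le (o : V) (n : ℕ) : o ∈ {z | G.dist o z ≤ n} := by
  simp

/-! ## §5 Transport under isomorphisms; stability under automorphisms fixing the centre -/

/-- An isomorphism maps Mathlib balls onto balls (centre to centre, same radius). [cite: MeyerSolleveld2010, §4 (𝒢-invariant Σ)] [cite: Korman2004, §9 Lemma 38] -/
theorem image_ball_iso (φ : G ≃g G') (o : V) (r : ℕ∞) : φ '' G.ball o r = G'.ball (φ o) r := by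
  ext y
  constructor
  · rintro ⟨x, hx, rfl⟩
    rw [mem_ball, edist_iso]
    exact hx
  · intro hy
    refine ⟨φ.symm y, ?_, RelIso.apply_symm_apply φ y⟩
    have h := edist_iso φ (φ.symm y) o
    rw [RelIso.apply_symm_apply] at h
    rw [mem_ball, ← h]
    exact hy

/-- **An isomorphism maps the closed ball about `o` onto the closed ball about `φ o`.** [cite: MeyerSolleveld2010, §4 (𝒢-invariant Σ)] -/
theorem image_setOf_dist_le_iso (φ : G ≃g G') (o : V) (n : ℕ) : φ '' {x | G.dist o x ≤ n} = {y | G'.dist (φ o) y ≤ n} := by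
  ext y
  constructor
  · rintro ⟨x, hx, rfl⟩
    rw [mem_setOf_eq, TreeLayers.dist_iso_apply]
    exact hx
  · intro hy
    refine ⟨φ.symm y, ?_, RelIso.apply_symm_apply φ y⟩
    have h := TreeLayers.dist_iso_apply φ o (φ.symm y)
    rw [RelIso.apply_symm_apply] at h
    rw [mem_setOf_eq, ← h]
    exact hy

/-- **STABILISER-STABLE: an automorphism fixing the centre maps the closed ball onto itself.** [cite: MeyerSolleveld2010, §4 (𝒢-invariant Σ)] [cite: Korman2004, §9 Lemma 38] -/
theorem image_setOf_dist_le_of_apply_eq (φ : G ≃g G) {o : V} (ho : φ o = o) (n : ℕ) : φ '' {x | G.dist o x ≤ n} = {x | G.dist o x ≤ n} := by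
  rw [image_setOf_dist_le_iso, ho]

/-- Membership form: `φ x ∈ B(o, n) ↔ x ∈ B(o, n)` when `φ o = o`. [cite: MeyerSolleveld2010, §4] -/
theorem apply_mem_setOf_dist_le_iff (φ : G ≃g G) {o : V} (ho : φ o = o) (n : ℕ) (x : V) : φ x ∈ {z | G.dist o z ≤ n} ↔ x ∈ {z | G.dist o z ≤ n} := by
  have h := TreeLayers.dist_iso_apply φ o x
  rw [ho] at h
  simp only [mem_setOf_eq, h]

/-- `MapsTo` form. [cite: MeyerSolleveld2010, §4] -/
theorem mapsTo_setOf_dist_le (φ : G ≃g G) {o : V} (ho : φ o = o) (n : ℕ) : MapsTo φ {z | G.dist o z ≤ n} {z | G.dist o z ≤ n} :=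
  fun x hx => (apply_mem_setOf_dist_le_iff φ ho n x).2 hx

/-- The ends of the image edge `φ·e` are the images of the ends of `e` (a morphism of graphs commutes with the extremity maps). [cite: Serre1980Trees, I.2.1 (morphisms of graphs)] -/
theorem mem_mapEdgeSet_iff (φ : G ≃g G') (e : G.edgeSet) (y : W) : y ∈ ((φ.mapEdgeSet e : G'.edgeSet) : Sym2 W) ↔ ∃ x ∈ (e : Sym2 V), φ x = y := by
  rw [Iso.mapEdgeSet_apply, Hom.mapEdgeSet_coe, Sym2.mem_map]
  rfl

/-- **Edges inside a `φ`-stable vertex set are `φ.mapEdgeSet`-stable**: if `φ x ∈ S ↔ x ∈ S` for all `x`, then `φ·e ⊆ S ↔ e ⊆ S` (apply with `S = B(o, n)`, `φ o = o`, via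
`apply_mem_setOf_dist_le_iff`). [cite: MeyerSolleveld2010, §4 (𝒢-invariant subcomplex)] -/
theorem forall_mem_mapEdgeSet_iff (φ : G ≃g G) {S : Set V} (hS : ∀ x, φ x ∈ S ↔ x ∈ S) (e : G.edgeSet) :
    (∀ v ∈ ((φ.mapEdgeSet e : G.edgeSet) : Sym2 V), v ∈ S) ↔ ∀ v ∈ (e : Sym2 V), v ∈ S := by
  constructor
  · intro h v hv
    exact (hS v).1 (h (φ v) ((mem_mapEdgeSet_iff φ e (φ v)).2 ⟨v, hv, rfl⟩))
  · intro h y hy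
    obtain ⟨x, hx, rfl⟩ := (mem_mapEdgeSet_iff φ e y).1 hy
    exact (hS x).2 (h x hx)

/-- The edges inside the closed ball are stable under an automorphism fixing the centre. [cite: MeyerSolleveld2010, §4] [cite: Korman2004, §9 Lemma 38] -/
theorem forall_mem_mapEdgeSet_iff_of_apply_eq (φ : G ≃g G) {o : V} (ho : φ o = o) (n : ℕ) (e : G.edgeSet) :
    (∀ v ∈ ((φ.mapEdgeSet e : G.edgeSet) : Sym2 V), v ∈ {z | G.dist o z ≤ n}) ↔ ∀ v ∈ (e : Sym2 V), v ∈ {z | G.dist o z ≤ n} :=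
  forall_mem_mapEdgeSet_iff φ (fun x => apply_mem_setOf_dist_le_iff φ ho n x) e

/-! ## §6 Finitely many edges inside a finite vertex set; a finite set fits in a ball; neighbours of a finite set -/

/-- The unordered pairs from a finite set are finite (plumbing for `finite_edgeSet_inside`). [folklore] -/
private theorem finite_sym2_of_finite {S : Set V} (hS : S.Finite) : S.sym2.Finite := by
  rw [Set.sym2_eq_mk_image]
  exact (hS.prod hS).image _

/-- **The edges of `G` with both ends in a finite vertex set `S` form a finite subset of `G.edgeSet`** (the `1`-cells `Σ¹` of a finite `Σ`). [cite: Korman2004, §5 Example 12]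
[cite: SchneiderStuhler1997, II.1] -/
theorem finite_edgeSet_inside {S : Set V} (hS : S.Finite) : {e : G.edgeSet | ∀ v ∈ (e : Sym2 V), v ∈ S}.Finite := by
  have h1 : {z : Sym2 V | ∀ v ∈ z, v ∈ S}.Finite := by
    refine (finite_sym2_of_finite hS).subset fun z hz => ?_
    induction z using Sym2.inductionOn with
    | hf a b => exact Set.mk_mem_sym2_iff.2 ⟨hz a (Sym2.mem_mk_left a b), hz b (Sym2.mem_mk_right a b)⟩
  exact (h1.preimage Subtype.val_injective.injOn : ((fun e : G.edgeSet => (e : Sym2 V)) ⁻¹' {z : Sym2 V | ∀ v ∈ z, v ∈ S}).Finite)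

/-- The same as a set of unordered pairs. [cite: SchneiderStuhler1997, II.1] -/
theorem finite_setOf_mem_edgeSet_inside {S : Set V} (hS : S.Finite) : {z : Sym2 V | z ∈ G.edgeSet ∧ ∀ v ∈ z, v ∈ S}.Finite := by
  refine (finite_sym2_of_finite hS).subset fun z hz => ?_
  induction z using Sym2.inductionOn with
  | hf a b => exact Set.mk_mem_sym2_iff.2 ⟨hz.2 a (Sym2.mem_mk_left a b), hz.2 b (Sym2.mem_mk_right a b)⟩

/-- A `Finset` lies in the closed ball of radius `sup dist`. [cite: MeyerSolleveld2010, §4 (Σ₀ ⊆ Σ)] -/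
theorem subset_setOf_dist_le_sup (s : Finset V) (o : V) : (↑s : Set V) ⊆ {x | G.dist o x ≤ s.sup (G.dist o)} :=
  fun _ hx => Finset.le_sup (f := G.dist o) hx

/-- **Every finite vertex set lies in some closed ball about any centre** (the radius `R ≥ max dist(o, ·)`). [cite: MeyerSolleveld2010, §4 (a finite convex Σ ⊇ Σ₀)]
[cite: Korman2004, §9 (a ball about o ∈ X^γ containing X^γ)] -/
theorem exists_subset_setOf_dist_le {F : Set V} (hF : F.Finite) (o : V) : ∃ n : ℕ, F ⊆ {x | G.dist o x ≤ n} :=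
  ⟨hF.toFinset.sup (G.dist o), fun _ hx => Finset.le_sup (f := G.dist o) (hF.mem_toFinset.2 hx)⟩

/-- The neighbours of a finite vertex set form a finite set (finite neighbourhoods). [cite: SchneiderStuhler1997, II.1] -/
theorem finite_setOf_exists_adj (hloc : ∀ v, (G.neighborSet v).Finite) {F : Set V} (hF : F.Finite) : {y | ∃ x ∈ F, G.Adj x y}.Finite :=
  (hF.biUnion fun x _ => hloc x).subset fun _ ⟨_, hx, hxy⟩ => mem_biUnion hx hxy

/-- A neighbour of a vertex of `B(o, n)` lies in `B(o, n+1)` (connected graph; triangle inequality for the path metric). [cite: Serre1980Trees, I.2 (paths, distance)] [cite: Korman2004, §9 Lemma 38] -/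
theorem dist_le_succ_of_adj (hconn : G.Connected) {o x y : V} {n : ℕ} (hx : G.dist o x ≤ n) (hxy : G.Adj x y) : G.dist o y ≤ n + 1 :=
  calc G.dist o y ≤ G.dist o x + G.dist x y := hconn.dist_triangle
    _ ≤ n + 1 := by rw [dist_eq_one_iff_adj.2 hxy]; exact Nat.add_le_add_right hx 1

/-! ## §7 The closed ball of a connected graph induces a connected subgraph (a subtree, in a tree) -/

/-- Every vertex on a walk from `o` is within `length` of `o`. [folklore] [cite: Serre1980Trees, I.2] -/
theorem dist_le_of_mem_support [DecidableEq V] {o x : V} (p : G.Walk o x) {u : V} (hu : u ∈ p.support) : G.dist o u ≤ p.length :=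
  (dist_le (p.takeUntil u hu)).trans (p.length_takeUntil_le_length hu)

/-- **The closed ball `{x | G.dist o x ≤ n}` of a connected graph induces a connected subgraph** (a shortest walk from the centre stays inside; for a tree,
`B(o,r)` is convex — a finite subtree). [cite: Korman2004, §5 Example 12] [cite: Serre1980Trees, I.2] -/
theorem connected_induce_setOf_dist_le (hconn : G.Connected) (o : V) (n : ℕ) : (G.induce {x | G.dist o x ≤ n}).Connected := by
  classical
  refine induce_connected_of_patches o (self_mem_setOf_dist_le o n) fun {v} hv => ?_
  obtain ⟨p, hp⟩ := hconn.exists_walk_length_eq_dist o v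
  refine ⟨{u | u ∈ p.support}, fun u hu => ?_, p.start_mem_support, p.end_mem_support, ?_⟩
  · exact (dist_le_of_mem_support p hu).trans (hp ▸ hv)
  · exact (p.connected_induce_support) _ _

end Literature.Combinatorics.SimpleGraph.ClosedBall
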